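import Literature.Probability.LatticeModels.FKIsingInterfaceTightness
import Literature.Probability.LatticeModels.FKIsingInterfaceTightnessProofs
import Literature.Probability.LatticeModels.FKIsingRSWHolds
import HarnessLib

/-!
# `fkInterface_traversalBound` holds: hypothesis (H1) of Aizenman–Burchard for the critical FK-Ising interface

Topic `Literature/Probability/LatticeModels` (family `crit-ising`); the discharge of the named fact
`Literature.Probability.LatticeModels.fkInterface_traversalBound` of `FKIsingInterfaceTightness.lean`
— the uniform multiple-traversal bound (C1) for the exploration polygon of the critical FK-Ising
model in discrete Dobrushin domains (Duminil-Copin–Smirnov 2012, Thm. 6.1, eqs. (6.1)–(6.2); it is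
hypothesis (H1) of Aizenman–Burchard 1999, Thm. 1.1, in the half-annulus form of their Appendix A).

The proof is the published one, assembled in the tree:

* `FKIsingInterfaceTightnessProofs.fkInterface_traversalBound_of_annulusCrossing_le` — DCS §6.1:
  `2(j + N)` traversals of a shell force `j` open arms across disjoint square annuli in distinct
  local clusters off the wired arc (`MedialTraversalSectors`, `MedialTraversalArcs`,
  `TightPolyline`, the three-arcs lemma of `PlaneTopology/AnnulusArcs`), which cost `(c^m)^j` by
  successive conditioning under the wired random-cluster measure (`RandomClusterMultiCrossing`,
  `RandomClusterRegionCrossingBound`, `RandomClusterSuccessiveConditioning`,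
  `RandomClusterConditionalDomination`), given the annulus estimate `fkIsing_annulusCrossing_le`
  (DCS Lemma 6.3);
* `FKIsingAnnulusCrossingRSW.fkIsing_annulusCrossing_le_of_fkIsing_rsw` — Lemma 6.3 from the RSW
  bound with free boundary conditions;
* `FKIsingRSWHolds.fkIsing_rsw_holds` — the RSW bound itself, Duminil-Copin–Hongler–Nolin 2011,
  Thm. 1 (= DCS 2012, Thm. 3.16): Smirnov's observable, the second-moment argument and the
  half-plane arm estimates (Props. 13–14, Lemma 15) with the discrete potential theory of §3.2.

Kept in its own file so that `FKIsingInterfaceTightnessProofs.lean` does not acquire the import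
closure of the RSW programme. Theorem only; no named fact is introduced.

## References

* H. Duminil-Copin, S. Smirnov, *Conformal invariance of lattice models*, in: Probability and
  Statistical Physics in Two and More Dimensions, Clay Math. Proc. 15 (2012) 213–276
  (arXiv:1109.1549), Thm. 6.1, Lemma 6.3, Thm. 3.16. [DuminilCopinSmirnov2012Clay]
* M. Aizenman, A. Burchard, *Hölder regularity and dimension bounds for random curves*, Duke
  Math. J. 99 (1999) 419–453 (arXiv:math/9801027), Thm. 1.1 (hypothesis H1) and Appendix A.
  [AizenmanBurchardDuke1999]
* H. Duminil-Copin, C. Hongler, P. Nolin, *Connection probabilities and RSW-type bounds for the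
  two-dimensional FK Ising model*, Comm. Pure Appl. Math. 64 (2011) 1165–1198, Thm. 1.
  [DuminilCopinHonglerNolin2011]
-/

namespace Literature.Probability.LatticeModels

/-- **(C1) for the critical FK-Ising interface holds**: the named fact `fkInterface_traversalBound`
(Duminil-Copin–Smirnov 2012, Thm. 6.1 (6.1)–(6.2) = hypothesis (H1) of Aizenman–Burchard 1999,
Thm. 1.1 / App. A, for the FK-Ising exploration polygon) is a theorem: the reduction
`fkInterface_traversalBound_of_fkIsing_rsw` (DCS §6.1 with Lemma 6.3) composed with
`fkIsing_rsw_holds` (Duminil-Copin–Hongler–Nolin 2011, Thm. 1).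
[cite: DuminilCopinSmirnov2012Clay, Thm. 6.1 and Lemma 6.3; AizenmanBurchardDuke1999, Thm. 1.1, App. A;
DuminilCopinHonglerNolin2011, Thm. 1] -/
theorem fkInterface_traversalBound_holds : fkInterface_traversalBound :=
  fkInterface_traversalBound_of_fkIsing_rsw fkIsing_rsw_holds

end Literature.Probability.LatticeModels
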